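import Literature.NumberTheory.DiophantineGeometry.FunctionFieldGCD
import Literature.NumberTheory.DiophantineGeometry.FunctionFieldGCDWronskianBound
import Literature.NumberTheory.DiophantineGeometry.FunctionFieldEulerCharacteristicCover
import Literature.NumberTheory.DiophantineGeometry.FunctionFieldPointCountRationalProofs
import Literature.NumberTheory.DiophantineGeometry.FunctionFieldSchmidtDegreeOneExtensionProofs
import HarnessLib

/-!
# Corvaja–Zannier's gcd bound for `S`-units over function fields: Corollary 2.3 (i) — the discharge

Sibling proof file of `Literature.NumberTheory.DiophantineGeometry.FunctionFieldGCD` (the named fact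
`CorvajaZannier2008_cor23`, vendored AS PRINTED). This file proves
`CorvajaZannier2008_cor23_holds : CorvajaZannier2008_cor23`, following the printed proof
(P. Corvaja, U. Zannier, J. Algebraic Geom. 17 (2008) 295–333 = arXiv:math/0512074, §2, proof of
Cor. 2.3, p. 5 of the arXiv text) on top of

* `FunctionFieldGCDWronskianBound` — Propositions 2.1–2.2 (`CorvajaZannier2008_prop22`: either
  `[K(a,b) : K(a)] ≤ h` or `n·Σ_{v∉S} min{v(1-a),v(1-b)} ≤ (h+2k)H(b) + kH(a) + (n(n-1)/2)χ`,
  `n = hk + h + k`), and the trivial bound `Σ_{v∉S} min ≤ H(b)` (`czMin_le_finrank`);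
* `FunctionFieldEulerCharacteristicCover` — the cover remark `χ_F ≥ [F : F₀] χ_{F₀}`
  (`card_add_genus_ge_mul_of_cover`) and `χ ≥ 1` (`one_le_eulerChar_of_indep`).

## Proof (as printed, with the bookkeeping for a non-primitive pair)

Both `a, b` are non-constant (a constant `a = λ` would give the relation `a¹ = λ b⁰`). By symmetry
assume `H(a) ≥ H(b)` (`H(y) = [F : K(y)]`, the number of poles). The paper reduces to `κ(𝒞) = κ(a,b)`
by the cover remark; we keep `F` and record instead `H(a) = δ d` with `δ = [K(a)(b) : K(a)]`,
`d = [F : K(a)(b)]`, and `χ ≥ d · χ(K(a,b)) ≥ d` (cover remark for `F ⊇ K(a)(b)`, applied to the exact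
set of zeros and poles, and `χ ≥ 1` downstairs: `#S ≥ 3` for independent units). Then
(`CorvajaZannier2008_cor23_arith`, pure real arithmetic): with `X = H(a)H(b)χ`, `x = X^{1/3}`,
`c = 2^{1/3}`, `A = (4H(a)²/H(b)χ)^{1/3} = c²H(a)/x`, `B = c²H(b)/x`, `h = ⌊A⌋ - 1`, `k = ⌊B⌋ - 1`:
if `k < 1` then `B < 2`, `H(b)³ < 2X` and `Σ min ≤ H(b) < (2X)^{1/3}`; else `h ≥ k ≥ 1` and Prop. 2.2
applies: in the first alternative `δ ≤ h` we get `H(a) ≤ hd < Ad`, `X < 4d³`, hence (as `χ ≥ d`,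
`Σ min ≤ H(b) ≤ H(a)`) `Σ min < 2d ≤ 2χ` and `(Σ min)³ ≤ (Σ min)·H(a)H(b) < 2X`; in the second,
`(h+2k)/n ≤ 3/(k+2) ≤ 3/B`, `k/n ≤ 1/(h+2) ≤ 1/A`, `(n-1)/2 = ((h+1)(k+1)-2)/2 ≤ AB/2 - 1` give
`Σ min ≤ 3H(b)/B + H(a)/A + ABχ/2 - χ = 3·2^{1/3}·X^{1/3} - χ`, as printed.

## References

* P. Corvaja, U. Zannier, J. Algebraic Geom. 17 (2008) 295–333, §2, Cor. 2.3 and its proof.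
  [CorvajaZannier2007]
-/

noncomputable section

open scoped Classical IntermediateField
open Module

namespace Literature.NumberTheory.DiophantineGeometry

open AlgFunctionField

/-! ### The arithmetic of the proof of Cor. 2.3 (i) -/

/-- **The real arithmetic of the proof of Cor. 2.3 (i)** (p. 5 of arXiv:math/0512074). Inputs: heights
`H(a) = δ d ≥ H(b) ≥ 1`, `1 ≤ d ≤ χ`, the trivial bound `M ≤ H(b)` for `M = Σ_{v∉S} min{v(1-a),v(1-b)}`,
and Prop. 2.2 for all `h, k ≥ 1` (first alternative `δ ≤ h`). Output: `M ≤ 3 ∛2 (H(a)H(b)χ)^{1/3}`.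
[cite: CorvajaZannier2007, Cor. 2.3 (proof)] -/
theorem CorvajaZannier2008_cor23_arith {Ha Hb χ d δ : ℕ} {M : ℤ}
    (hHb : 1 ≤ Hb) (hab : Hb ≤ Ha) (hd : 1 ≤ d) (hχd : d ≤ χ) (hHa : Ha = δ * d)
    (hMb : M ≤ Hb)
    (hP : ∀ h k : ℕ, 1 ≤ h → 1 ≤ k → δ ≤ h ∨
      ((h * k + h + k : ℕ) : ℤ) * M ≤ ((h + 2 * k : ℕ) : ℤ) * Hb + (k : ℤ) * Ha +
        (((h * k + h + k) * (h * k + h + k - 1) / 2 : ℕ) : ℤ) * χ) :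
    (M : ℝ) ≤ 3 * (2 * (Ha : ℝ) * Hb * χ) ^ ((1 : ℝ) / 3) := by
  -- positivity of the data
  have hHa1 : 1 ≤ Ha := le_trans hHb hab
  have hχ1 : 1 ≤ χ := le_trans hd hχd
  have hHaR : (1 : ℝ) ≤ Ha := by exact_mod_cast hHa1
  have hHbR : (1 : ℝ) ≤ Hb := by exact_mod_cast hHb
  have hχR : (1 : ℝ) ≤ χ := by exact_mod_cast hχ1
  have habR : (Hb : ℝ) ≤ Ha := by exact_mod_cast hab
  set X : ℝ := (Ha : ℝ) * Hb * χ with hX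
  have hX1 : 1 ≤ X := by
    have h1 : (1 : ℝ) ≤ (Ha : ℝ) * Hb := by nlinarith
    have h2 : (Ha : ℝ) * Hb ≤ (Ha : ℝ) * Hb * χ := le_mul_of_one_le_right (by positivity) hχR
    rw [hX]; linarith
  have hX0 : 0 < X := by linarith
  -- cube roots
  set x : ℝ := X ^ ((1 : ℝ) / 3) with hx
  set c : ℝ := (2 : ℝ) ^ ((1 : ℝ) / 3) with hc
  have hx0 : 0 < x := Real.rpow_pos_of_pos hX0 _
  have hc0 : 0 < c := Real.rpow_pos_of_pos two_pos _
  have hx3 : x ^ 3 = X := by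
    rw [hx, ← Real.rpow_natCast, ← Real.rpow_mul hX0.le]; norm_num
  have hc3 : c ^ 3 = 2 := by
    rw [hc, ← Real.rpow_natCast, ← Real.rpow_mul zero_le_two]; norm_num
  have hc6 : c ^ 6 = 4 := by
    calc c ^ 6 = (c ^ 3) ^ 2 := by ring
      _ = 4 := by rw [hc3]; norm_num
  have hrhs : 3 * (2 * (Ha : ℝ) * Hb * χ) ^ ((1 : ℝ) / 3) = 3 * (c * x) := by
    rw [show 2 * (Ha : ℝ) * Hb * χ = 2 * X by rw [hX]; ring, Real.mul_rpow zero_le_two hX0.le]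
  rw [hrhs]
  have hcx : 0 < c * x := mul_pos hc0 hx0
  -- trivial case `M ≤ 0`
  rcases le_or_gt M 0 with hM0 | hM0
  · have : (M : ℝ) ≤ 0 := by exact_mod_cast hM0
    linarith
  have hMR : (0 : ℝ) ≤ M := by exact_mod_cast hM0.le
  -- a cube comparison: `u³ < 2X ⇒ u < c x`
  have hcube : ∀ u : ℝ, 0 ≤ u → u ^ 3 < 2 * X → u < c * x := by
    intro u _ h
    have : u ^ 3 < (c * x) ^ 3 := by rw [mul_pow, hc3, hx3]; exact h
    exact lt_of_pow_lt_pow_left₀ 3 hcx.le this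
  -- the parameters `A, B` and `h, k`
  set A : ℝ := c ^ 2 * Ha / x with hA
  set B : ℝ := c ^ 2 * Hb / x with hB
  have hB0 : 0 ≤ B := by rw [hB]; positivity
  have hA0 : 0 ≤ A := by rw [hA]; positivity
  have hBA : B ≤ A := by
    rw [hA, hB]
    exact div_le_div_of_nonneg_right (mul_le_mul_of_nonneg_left habR (by positivity)) hx0.le
  rcases lt_or_ge (⌊B⌋₊) 2 with hfloor | hfloor
  · -- `k < 1`: `B < 2`, so `Hb³ < 2X` and `M ≤ Hb < c x`
    have hB2 : B < 2 := by
      have h1 := Nat.lt_floor_add_one B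
      have h2 : (⌊B⌋₊ : ℝ) ≤ 1 := by exact_mod_cast Nat.lt_succ_iff.1 hfloor
      linarith
    have h1 : c ^ 2 * Hb < 2 * x := by
      rw [hB, div_lt_iff₀ hx0] at hB2; linarith
    have h2 : (Hb : ℝ) ^ 3 < 2 * X := by
      have hpos : 0 ≤ c ^ 2 * Hb := by positivity
      have h3 := pow_lt_pow_left₀ h1 hpos three_ne_zero
      have e1 : (c ^ 2 * (Hb : ℝ)) ^ 3 = 4 * (Hb : ℝ) ^ 3 := by
        calc (c ^ 2 * (Hb : ℝ)) ^ 3 = c ^ 6 * (Hb : ℝ) ^ 3 := by ring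
          _ = 4 * (Hb : ℝ) ^ 3 := by rw [hc6]
      have e2 : (2 * x) ^ 3 = 8 * X := by rw [mul_pow, hx3]; norm_num
      rw [e1, e2] at h3
      linarith
    have h3 : (Hb : ℝ) < c * x := hcube _ (by positivity) h2
    have h4 : (M : ℝ) ≤ Hb := by exact_mod_cast hMb
    linarith
  · -- `k ≥ 1`; `h ≥ k`
    set kk : ℕ := ⌊B⌋₊ - 1 with hkk
    set hh : ℕ := ⌊A⌋₊ - 1 with hhh
    have hfloorA : ⌊B⌋₊ ≤ ⌊A⌋₊ := Nat.floor_le_floor hBA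
    have hk1 : 1 ≤ kk := by omega
    have hkh : kk ≤ hh := by omega
    have hh1 : 1 ≤ hh := le_trans hk1 hkh
    have hkhR : (kk : ℝ) ≤ hh := by exact_mod_cast hkh
    have hk0R : (0 : ℝ) ≤ kk := by positivity
    have hkR : (kk : ℝ) + 1 = ⌊B⌋₊ := by
      have h' : kk + 1 = ⌊B⌋₊ := by omega
      have := congrArg (fun m : ℕ ↦ (m : ℝ)) h'
      push_cast at this; exact this
    have hhR : (hh : ℝ) + 1 = ⌊A⌋₊ := by
      have h' : hh + 1 = ⌊A⌋₊ := by omega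
      have := congrArg (fun m : ℕ ↦ (m : ℝ)) h'
      push_cast at this; exact this
    have hBk : B ≤ kk + 2 := by
      have := (Nat.lt_floor_add_one B).le; rw [← hkR] at this; linarith
    have hAh : A ≤ hh + 2 := by
      have := (Nat.lt_floor_add_one A).le; rw [← hhR] at this; linarith
    have hhA : (hh : ℝ) + 1 ≤ A := by rw [hhR]; exact Nat.floor_le hA0
    have hkB : (kk : ℝ) + 1 ≤ B := by rw [hkR]; exact Nat.floor_le hB0
    rcases hP hh kk hh1 hk1 with hfirst | hsecond
    · -- first alternative: `Ha ≤ h d < A d`, so `X < 4d³`, `M < 2d ≤ 2χ`, `M³ ≤ M·Ha·Hb < 2X`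
      have h1 : (Ha : ℝ) ≤ hh * d := by
        have : Ha ≤ hh * d := by rw [hHa]; exact Nat.mul_le_mul_right d hfirst
        exact_mod_cast this
      have hd0 : (0 : ℝ) < d := by exact_mod_cast hd
      have h2 : (Ha : ℝ) < A * d := by
        have : (hh : ℝ) * d < A * d := mul_lt_mul_of_pos_right (by linarith) hd0
        linarith
      have h3 : x < c ^ 2 * d := by
        -- `Ha < (c² Ha / x) d` gives `Ha x < c² Ha d`
        rw [hA] at h2
        have h2' : (Ha : ℝ) * x < c ^ 2 * Ha * d := by
          have := mul_lt_mul_of_pos_right h2 hx0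
          rwa [div_mul_eq_mul_div, div_mul_cancel_of_imp (fun h ↦ absurd h hx0.ne')] at this
        have hHa0 : (0 : ℝ) < Ha := by linarith
        have : (Ha : ℝ) * x < Ha * (c ^ 2 * d) := by linarith
        exact lt_of_mul_lt_mul_left this hHa0.le
      have h4 : X < 4 * (d : ℝ) ^ 3 := by
        have h5 := pow_lt_pow_left₀ h3 hx0.le three_ne_zero
        have e1 : (c ^ 2 * (d : ℝ)) ^ 3 = 4 * (d : ℝ) ^ 3 := by
          calc (c ^ 2 * (d : ℝ)) ^ 3 = c ^ 6 * (d : ℝ) ^ 3 := by ring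
            _ = 4 * (d : ℝ) ^ 3 := by rw [hc6]
        rw [hx3, e1] at h5
        exact h5
      have h4' : (Ha : ℤ) * Hb * χ < 4 * (d : ℤ) ^ 3 := by
        have : ((Ha : ℤ) * Hb * χ : ℝ) < 4 * (d : ℝ) ^ 3 := by push_cast; rw [hX] at h4; exact h4
        exact_mod_cast this
      -- integer arithmetic
      have e2 : M ^ 2 ≤ (Ha : ℤ) * Hb := by
        have h1 : M * M ≤ (Hb : ℤ) * Hb := mul_le_mul hMb hMb hM0.le (by positivity)
        have h2 : (Hb : ℤ) * Hb ≤ Ha * Hb := mul_le_mul_of_nonneg_right (by exact_mod_cast hab) (by positivity)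
        have h3 : M ^ 2 = M * M := sq M
        linarith only [h1, h2, h3]
      have hM2d : M < 2 * d := by
        by_contra hle
        push Not at hle
        have hd0' : (0 : ℤ) ≤ 2 * d := by positivity
        have e1 : (2 * (d : ℤ)) * (2 * d) ≤ M * M := mul_le_mul hle hle hd0' (hd0'.trans hle)
        have e3 : (d : ℤ) ^ 2 * d ≤ (d : ℤ) ^ 2 * χ :=
          mul_le_mul_of_nonneg_left (by exact_mod_cast hχd) (by positivity)
        have e4 : (Ha : ℤ) * Hb * χ < 4 * d ^ 2 * χ := by
          have : (4 : ℤ) * d ^ 3 = 4 * (d ^ 2 * d) := by ring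
          linarith only [h4', e3, this]
        have e5 : (Ha : ℤ) * Hb < 4 * d ^ 2 := lt_of_mul_lt_mul_right e4 (by positivity)
        have e6 : M * M = M ^ 2 := (sq M).symm
        have e7 : (2 * (d : ℤ)) * (2 * d) = 4 * d ^ 2 := by ring
        linarith only [e1, e2, e5, e6, e7]
      have hM3 : (M : ℝ) ^ 3 < 2 * X := by
        have hχ' : (d : ℤ) ≤ χ := by exact_mod_cast hχd
        have hM2χ : M < 2 * χ := by linarith only [hM2d, hχ']
        have hHaHb1 : (1 : ℤ) ≤ Ha * Hb := by
          have h1 : (1 : ℤ) ≤ Ha := by exact_mod_cast hHa1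
          have h2 : (1 : ℤ) ≤ Hb := by exact_mod_cast hHb
          nlinarith
        have e5 : M ^ 3 < 2 * ((Ha : ℤ) * Hb * χ) := by
          have h1 : M * M ^ 2 ≤ M * (Ha * Hb) := mul_le_mul_of_nonneg_left e2 hM0.le
          have h2 : M * ((Ha : ℤ) * Hb) < 2 * χ * (Ha * Hb) := mul_lt_mul_of_pos_right hM2χ (by linarith)
          have h3 : M ^ 3 = M * M ^ 2 := by ring
          have h4 : 2 * ((Ha : ℤ) * Hb * χ) = 2 * χ * (Ha * Hb) := by ring
          linarith only [h1, h2, h3, h4]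
        have : ((M ^ 3 : ℤ) : ℝ) < ((2 * ((Ha : ℤ) * Hb * χ) : ℤ) : ℝ) := by exact_mod_cast e5
        push_cast at this
        rw [hX]; exact this
      have := hcube (M : ℝ) hMR hM3
      linarith
    · -- second alternative: the main inequality
      set n : ℕ := hh * kk + hh + kk with hn
      have hn1 : 1 ≤ n := by rw [hn]; omega
      have hnR : (0 : ℝ) < n := by exact_mod_cast hn1
      have hnR' : (n : ℝ) = hh * kk + hh + kk := by rw [hn]; push_cast; ring
      -- `N = n(n-1)/2` exactly
      set N' : ℝ := ((n * (n - 1) / 2 : ℕ) : ℝ) with hN'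
      have hN2 : N' * 2 = (n : ℝ) * ((n : ℝ) - 1) := by
        have hdvd : 2 ∣ n * (n - 1) := (Nat.even_mul_pred_self n).two_dvd
        have h' : (n * (n - 1) / 2) * 2 = n * (n - 1) := Nat.div_mul_cancel hdvd
        have h'' := congrArg (fun m : ℕ ↦ (m : ℝ)) h'
        push_cast [Nat.cast_sub hn1] at h''
        rw [hN']; exact h''
      -- the real form of the second alternative
      have E0 : (n : ℝ) * M ≤ ((hh : ℝ) + 2 * kk) * Hb + (kk : ℝ) * Ha + N' * χ := by
        have h0 := hsecond
        have h' : (((n : ℤ) * M : ℤ) : ℝ) ≤ ((((hh + 2 * kk : ℕ) : ℤ) * Hb + (kk : ℤ) * Ha +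
            (((n * (n - 1) / 2 : ℕ) : ℤ)) * χ : ℤ) : ℝ) := by exact_mod_cast h0
        push_cast at h'
        rw [hN']; exact h'
      -- the auxiliary inequalities
      have E1 : c ^ 2 * Hb ≤ ((kk : ℝ) + 2) * x := by
        rw [hB, div_le_iff₀ hx0] at hBk; linarith
      have E2 : c ^ 2 * Ha ≤ ((hh : ℝ) + 2) * x := by
        rw [hA, div_le_iff₀ hx0] at hAh; linarith
      have E3 : ((hh : ℝ) + 1) * ((kk : ℝ) + 1) * x ^ 2 ≤ c ^ 4 * Ha * Hb := by
        have h1 : ((hh : ℝ) + 1) * ((kk : ℝ) + 1) ≤ A * B :=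
          mul_le_mul hhA hkB (by positivity) hA0
        have h2 : A * B * x ^ 2 = c ^ 4 * Ha * Hb := by
          rw [hA, hB]; field_simp
        have h3 := mul_le_mul_of_nonneg_right h1 (sq_nonneg x)
        rw [h2] at h3; exact h3
      have hkk2 : (kk : ℝ) * kk ≤ hh * kk := mul_le_mul_of_nonneg_right hkhR hk0R
      have E4 : ((hh : ℝ) + 2 * kk) * ((kk : ℝ) + 2) ≤ 3 * n := by
        have e1 : ((hh : ℝ) + 2 * kk) * ((kk : ℝ) + 2) = hh * kk + 2 * hh + 2 * (kk * kk) + 4 * kk := by ring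
        have e2 : (3 : ℝ) * n = 3 * (hh * kk) + 3 * hh + 3 * kk := by rw [hnR']; ring
        linarith only [e1, e2, hkk2, hkhR]
      have E5 : (kk : ℝ) * ((hh : ℝ) + 2) ≤ n := by
        have e1 : (kk : ℝ) * ((hh : ℝ) + 2) = hh * kk + 2 * kk := by ring
        linarith only [e1, hnR', hkhR]
      have E7 : (n : ℝ) - 1 = ((hh : ℝ) + 1) * ((kk : ℝ) + 1) - 2 := by rw [hnR']; ring
      -- products
      have P1 : ((hh : ℝ) + 2 * kk) * Hb * (c ^ 2 * x ^ 2) ≤ 3 * n * x ^ 3 :=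
        calc ((hh : ℝ) + 2 * kk) * Hb * (c ^ 2 * x ^ 2) = ((hh : ℝ) + 2 * kk) * x ^ 2 * (c ^ 2 * Hb) := by ring
          _ ≤ ((hh : ℝ) + 2 * kk) * x ^ 2 * (((kk : ℝ) + 2) * x) :=
              mul_le_mul_of_nonneg_left E1 (by positivity)
          _ = x ^ 3 * (((hh : ℝ) + 2 * kk) * ((kk : ℝ) + 2)) := by ring
          _ ≤ x ^ 3 * (3 * n) := mul_le_mul_of_nonneg_left E4 (by positivity)
          _ = 3 * n * x ^ 3 := by ring
      have P2 : (kk : ℝ) * Ha * (c ^ 2 * x ^ 2) ≤ n * x ^ 3 :=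
        calc (kk : ℝ) * Ha * (c ^ 2 * x ^ 2) = (kk : ℝ) * x ^ 2 * (c ^ 2 * Ha) := by ring
          _ ≤ (kk : ℝ) * x ^ 2 * (((hh : ℝ) + 2) * x) := mul_le_mul_of_nonneg_left E2 (by positivity)
          _ = x ^ 3 * ((kk : ℝ) * ((hh : ℝ) + 2)) := by ring
          _ ≤ x ^ 3 * n := mul_le_mul_of_nonneg_left E5 (by positivity)
          _ = n * x ^ 3 := by ring
      have hχ0 : (0 : ℝ) ≤ χ := by positivity
      have P3 : N' * χ * (c ^ 2 * x ^ 2) ≤ 2 * n * x ^ 3 - n * c ^ 2 * x ^ 2 * χ := by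
        have h1 : ((n : ℝ) - 1) * x ^ 2 ≤ c ^ 4 * Ha * Hb - 2 * x ^ 2 := by
          rw [E7]; linarith only [E3]
        have h2 : c ^ 6 * Ha * Hb * χ = 4 * x ^ 3 := by rw [hc6, hx3, hX]; ring
        calc N' * χ * (c ^ 2 * x ^ 2) = (N' * 2) * (χ * c ^ 2 * x ^ 2) / 2 := by ring
          _ = ((n : ℝ) * ((n : ℝ) - 1)) * (χ * c ^ 2 * x ^ 2) / 2 := by rw [hN2]
          _ = ((n : ℝ) * χ * c ^ 2 / 2) * (((n : ℝ) - 1) * x ^ 2) := by ring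
          _ ≤ ((n : ℝ) * χ * c ^ 2 / 2) * (c ^ 4 * Ha * Hb - 2 * x ^ 2) :=
              mul_le_mul_of_nonneg_left h1 (by positivity)
          _ = (n : ℝ) * (c ^ 6 * Ha * Hb * χ) / 2 - n * c ^ 2 * x ^ 2 * χ := by ring
          _ = (n : ℝ) * (4 * x ^ 3) / 2 - n * c ^ 2 * x ^ 2 * χ := by rw [h2]
          _ = 2 * n * x ^ 3 - n * c ^ 2 * x ^ 2 * χ := by ring
      have P0 : (n : ℝ) * M * (c ^ 2 * x ^ 2) ≤
          (((hh : ℝ) + 2 * kk) * Hb + (kk : ℝ) * Ha + N' * χ) * (c ^ 2 * x ^ 2) :=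
        mul_le_mul_of_nonneg_right E0 (by positivity)
      have hexp : (((hh : ℝ) + 2 * kk) * Hb + (kk : ℝ) * Ha + N' * χ) * (c ^ 2 * x ^ 2) =
          ((hh : ℝ) + 2 * kk) * Hb * (c ^ 2 * x ^ 2) + (kk : ℝ) * Ha * (c ^ 2 * x ^ 2) +
            N' * χ * (c ^ 2 * x ^ 2) := by ring
      have hsum : (n : ℝ) * M * (c ^ 2 * x ^ 2) ≤ 6 * n * x ^ 3 - n * c ^ 2 * x ^ 2 * χ := by
        linarith only [P0, P1, P2, P3, hexp]
      -- divide by `n x²` and use `6/c² = 3c`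
      have hnx : (0 : ℝ) < n * x ^ 2 := by positivity
      have hdiv : (M : ℝ) * c ^ 2 ≤ 6 * x - c ^ 2 * χ := by
        have e1 : (n : ℝ) * M * (c ^ 2 * x ^ 2) = (n * x ^ 2) * (M * c ^ 2) := by ring
        have e2 : 6 * (n : ℝ) * x ^ 3 - n * c ^ 2 * x ^ 2 * χ = (n * x ^ 2) * (6 * x - c ^ 2 * χ) := by ring
        rw [e1, e2] at hsum
        exact le_of_mul_le_mul_left hsum hnx
      have h6 : 6 * x = 3 * (c * x) * c ^ 2 := by
        have : 3 * (c * x) * c ^ 2 = 3 * x * c ^ 3 := by ring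
        rw [this, hc3]; ring
      have hc2 : (0 : ℝ) < c ^ 2 := by positivity
      have h7 : (M : ℝ) * c ^ 2 ≤ (3 * (c * x) - χ) * c ^ 2 := by
        have : (3 * (c * x) - χ) * c ^ 2 = 6 * x - c ^ 2 * χ := by rw [h6]; ring
        rw [this]; exact hdiv
      have h8 := le_of_mul_le_mul_right h7 hc2
      linarith


/-! ### The corollary -/

section core

variable {K : Type} {F : Type} [Field K] [IsAlgClosed K] [CharZero K] [Field F] [Algebra K F]
  [IsAlgFunctionField K F]

omit [IsAlgClosed K] [CharZero K] [IsAlgFunctionField K F] in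
/-- A multiplicatively independent pair has no constant member: `a = λ ∈ K*` would give `a¹ = λ b⁰`.
[cite: CorvajaZannier2007, Cor. 2.3 (proof: "If one of a,b is constant, then it cannot be 1 …")] -/
theorem not_mem_range_of_indep {a b : F} (ha0 : a ≠ 0)
    (hindep : ∀ (r s : ℤ) (c : K), (r, s) ≠ (0, 0) → c ≠ 0 → a ^ r ≠ algebraMap K F c * b ^ s) :
    a ∉ Set.range (algebraMap K F) := by
  rintro ⟨c, hc⟩
  refine hindep 1 0 c (by simp) (fun h0 ↦ ha0 (by rw [← hc, h0, map_zero])) ?_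
  rw [zpow_one, zpow_zero, mul_one, hc]

omit [IsAlgClosed K] [CharZero K] [IsAlgFunctionField K F] in
/-- Symmetry of multiplicative independence. [folklore] -/
theorem indep_symm {a b : F}
    (hindep : ∀ (r s : ℤ) (c : K), (r, s) ≠ (0, 0) → c ≠ 0 → a ^ r ≠ algebraMap K F c * b ^ s) :
    ∀ (r s : ℤ) (c : K), (r, s) ≠ (0, 0) → c ≠ 0 → b ^ r ≠ algebraMap K F c * a ^ s := by
  intro r s c hrs hc h
  refine hindep s r c⁻¹ (fun h0 ↦ hrs (by simp only [Prod.mk.injEq] at h0 ⊢; exact ⟨h0.2, h0.1⟩))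
    (inv_ne_zero hc) ?_
  rw [h, map_inv₀, ← mul_assoc, inv_mul_cancel₀ ((_root_.map_ne_zero _).2 hc), one_mul]

/-- **Corvaja–Zannier 2008, Cor. 2.3 (i)**, the case `H(b) ≤ H(a)`, with heights as degrees
`H(y) = [F : K(y)]` and the left side as the finitely supported sum off `S`.
[cite: CorvajaZannier2007, Cor. 2.3 (i)] -/
theorem CorvajaZannier2008_cor23_of_le (S : Finset (PlaceOver K F)) {a b : F} (ha0 : a ≠ 0) (hb0 : b ≠ 0)
    (hunit : ∀ v : PlaceOver K F, v ∉ S → v.ord a = 0 ∧ v.ord b = 0)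
    (hindep : ∀ (r s : ℤ) (c : K), (r, s) ≠ (0, 0) → c ≠ 0 → a ^ r ≠ algebraMap K F c * b ^ s)
    (hab : finrank K⟮b⟯ F ≤ finrank K⟮a⟯ F) :
    (((∑ᶠ v : PlaceOver K F, (if v ∈ S then (0 : ℤ) else min (v.ord (1 - a)) (v.ord (1 - b)))) : ℤ) : ℝ) ≤
      3 * (2 * (finrank K⟮a⟯ F : ℝ) * (finrank K⟮b⟯ F : ℝ) *
        ((S.card : ℝ) + (2 * (genus K F : ℝ) - 2))) ^ ((1 : ℝ) / 3) := by
  haveI hic : IsIntegrallyClosedIn K F := isIntegrallyClosedIn_of_isAlgClosed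
  have hrat : ∀ P : PlaceOver K F, P.IsRational := PlaceOver.isRational_of_isAlgClosed
  have ha : a ∉ Set.range (algebraMap K F) := not_mem_range_of_indep ha0 hindep
  have hb : b ∉ Set.range (algebraMap K F) := not_mem_range_of_indep hb0 (indep_symm hindep)
  have hat : Transcendental K a := transcendental_of_not_mem_range ha
  have hbt : Transcendental K b := transcendental_of_not_mem_range hb
  -- the tower `K ⊆ K(a) ⊆ K(a)(b) ⊆ F`
  set L : IntermediateField K F := K⟮a⟯ with hL
  haveI hFD : FiniteDimensional L F := IsAlgFunctionField.finiteDimensional_adjoin_simple hat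
  haveI hFDb : FiniteDimensional K⟮b⟯ F := IsAlgFunctionField.finiteDimensional_adjoin_simple hbt
  have hbint : IsIntegral L b := IsIntegral.of_finite L b
  set E : IntermediateField L F := L⟮b⟯ with hE
  haveI hEfd : FiniteDimensional L E := IntermediateField.adjoin.finiteDimensional hbint
  set F₀ : IntermediateField K F := E.restrictScalars K with hF₀
  haveI hF₀fd : FiniteDimensional F₀ F := (inferInstance : FiniteDimensional E F)
  haveI hLff : IsAlgFunctionField K L := isAlgFunctionField_adjoin_simple hat
  haveI hEff : IsAlgFunctionField K E :=
    isAlgFunctionField_of_finiteDimensional (K := K) (F := (L : Type)) (F' := (E : Type))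
  haveI hF₀ff : IsAlgFunctionField K F₀ := hEff
  haveI hF₀ic : IsIntegrallyClosedIn K F₀ := isIntegrallyClosedIn_of_isAlgClosed
  have hrat₀ : ∀ P : PlaceOver K F₀, P.IsRational := PlaceOver.isRational_of_isAlgClosed
  -- degrees: `H(a) = δ d`
  set d : ℕ := finrank F₀ F with hd
  set δ : ℕ := (minpoly L b).natDegree with hδ
  have hδE : finrank L E = δ := IntermediateField.adjoin.finrank hbint
  have hHa : finrank L F = δ * d := by
    rw [← hδE]; exact (Module.finrank_mul_finrank L E F).symm
  have hd1 : 1 ≤ d := Module.finrank_pos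
  -- `a, b` as elements of `F₀`
  have haE : a ∈ F₀ := by
    rw [hF₀, IntermediateField.mem_restrictScalars]
    have := E.algebraMap_mem (IntermediateField.AdjoinSimple.gen K a)
    rwa [IntermediateField.AdjoinSimple.algebraMap_gen] at this
  have hbE : b ∈ F₀ := by
    rw [hF₀, IntermediateField.mem_restrictScalars]
    exact IntermediateField.mem_adjoin_simple_self L b
  set a₀ : F₀ := ⟨a, haE⟩ with ha₀def
  set b₀ : F₀ := ⟨b, hbE⟩ with hb₀def
  have ha₀ : algebraMap F₀ F a₀ = a := rfl
  have hb₀ : algebraMap F₀ F b₀ = b := rfl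
  have hKF₀ : ∀ c : K, algebraMap K F c = algebraMap F₀ F (algebraMap K F₀ c) := fun c ↦
    IsScalarTower.algebraMap_apply K F₀ F c
  have ha₀K : a₀ ∉ Set.range (algebraMap K F₀) := fun ⟨c, hc⟩ ↦ ha ⟨c, by rw [hKF₀, hc]; exact ha₀⟩
  have hb₀K : b₀ ∉ Set.range (algebraMap K F₀) := fun ⟨c, hc⟩ ↦ hb ⟨c, by rw [hKF₀, hc]; exact hb₀⟩
  have ha₀0 : a₀ ≠ 0 := fun h ↦ ha0 (by rw [← ha₀, h, map_zero])
  have hb₀0 : b₀ ≠ 0 := fun h ↦ hb0 (by rw [← hb₀, h, map_zero])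
  -- the exact sets of zeros and poles, downstairs and upstairs
  set S₀ : Finset (PlaceOver K F₀) := (principalDivisor K a₀).support ∪ (principalDivisor K b₀).support
    with hS₀def
  have hS₀ : ∀ P₀ : PlaceOver K F₀, P₀ ∈ S₀ ↔ P₀.ord a₀ ≠ 0 ∨ P₀.ord b₀ ≠ 0 := fun P₀ ↦ by
    rw [hS₀def, Finset.mem_union, Finsupp.mem_support_iff, Finsupp.mem_support_iff,
      principalDivisor_apply_of_ne_zero ha₀0, principalDivisor_apply_of_ne_zero hb₀0]
  set Smin : Finset (PlaceOver K F) := S.filter (fun v ↦ v.ord a ≠ 0 ∨ v.ord b ≠ 0) with hSmin_def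
  have hSmin_sub : Smin ⊆ S := Finset.filter_subset _ _
  have hordres : ∀ (P : PlaceOver K F) (y : F₀),
      P.ord (algebraMap F₀ F y) ≠ 0 ↔ (P.restrict (K := K) (F := (F₀ : Type))).ord y ≠ 0 := by
    intro P y
    rw [P.ord_algebraMap_eq_mul (K := K) y]
    have he := P.one_le_ord_algebraMap_uniformizer (K := K) (F := (F₀ : Type))
    constructor
    · intro h h0; exact h (by rw [h0, mul_zero])
    · intro h h0
      rcases mul_eq_zero.1 h0 with h1 | h1
      · omega
      · exact h h1
  have hSmin : ∀ P : PlaceOver K F, P ∈ Smin ↔ P.restrict (K := K) (F := (F₀ : Type)) ∈ S₀ := by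
    intro P
    have e1 : P.ord a ≠ 0 ↔ (P.restrict (K := K) (F := (F₀ : Type))).ord a₀ ≠ 0 := hordres P a₀
    have e2 : P.ord b ≠ 0 ↔ (P.restrict (K := K) (F := (F₀ : Type))).ord b₀ ≠ 0 := hordres P b₀
    rw [hSmin_def, Finset.mem_filter, hS₀, ← e1, ← e2]
    constructor
    · exact fun h ↦ h.2
    · intro h
      refine ⟨?_, h⟩
      by_contra hPS
      obtain ⟨h1, h2⟩ := hunit P hPS
      rcases h with h | h
      · exact h h1
      · exact h h2
  -- the cover remark and `χ₀ ≥ 1`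
  have hcover := card_add_genus_ge_mul_of_cover (K := K) (F₀ := (F₀ : Type)) (F := F) hrat₀ hrat ha₀K S₀ Smin hSmin
  have hunit₀ : ∀ v₀ : PlaceOver K F₀, v₀ ∉ S₀ → v₀.ord a₀ = 0 ∧ v₀.ord b₀ = 0 := by
    intro v₀ hv
    rw [hS₀] at hv
    push Not at hv
    exact hv
  have hindep₀ : ∀ (r s : ℤ) (c : K), (r, s) ≠ (0, 0) → c ≠ 0 →
      a₀ ^ r ≠ algebraMap K F₀ c * b₀ ^ s := by
    intro r s c hrs hc h
    apply hindep r s c hrs hc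
    have := congrArg (algebraMap F₀ F) h
    rwa [map_zpow₀, map_mul, map_zpow₀, ← hKF₀] at this
  have hχ₀ := one_le_eulerChar_of_indep hrat₀ S₀ ha₀K hb₀K hunit₀ hindep₀
  have hχd : (d : ℤ) ≤ (S.card : ℤ) + 2 * genus K F - 2 := by
    have h1 : (Smin.card : ℤ) ≤ S.card := by exact_mod_cast Finset.card_le_card hSmin_sub
    have h2 : (d : ℤ) * 1 ≤ d * ((S₀.card : ℤ) + 2 * genus K F₀ - 2) :=
      mul_le_mul_of_nonneg_left hχ₀ (by positivity)
    have h3 : (finrank F₀ F : ℤ) = d := by rw [hd]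
    rw [h3] at hcover
    linarith
  -- the Euler characteristic as a natural number
  set χ : ℕ := ((S.card : ℤ) + 2 * genus K F - 2).toNat with hχdef
  have hχ : (χ : ℤ) = S.card + 2 * genus K F - 2 := Int.toNat_of_nonneg (by linarith)
  have hχd' : d ≤ χ := by
    have : (d : ℤ) ≤ χ := by rw [hχ]; exact hχd
    exact_mod_cast this
  -- the inputs of the arithmetic lemma
  have hHb1 : 1 ≤ finrank K⟮b⟯ F := Module.finrank_pos
  have hMb := czMin_le_finrank hrat S ha hb
  have hP : ∀ h k : ℕ, 1 ≤ h → 1 ≤ k → δ ≤ h ∨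
      ((h * k + h + k : ℕ) : ℤ) *
          (∑ᶠ v : PlaceOver K F, (if v ∈ S then (0 : ℤ) else min (v.ord (1 - a)) (v.ord (1 - b)))) ≤
        ((h + 2 * k : ℕ) : ℤ) * finrank K⟮b⟯ F + (k : ℤ) * finrank K⟮a⟯ F +
          (((h * k + h + k) * (h * k + h + k - 1) / 2 : ℕ) : ℤ) * χ := by
    intro h k hh hk
    have := CorvajaZannier2008_prop22 hrat S ha hb hunit hh hk
    have e : (S.card : ℤ) + (2 * genus K F - 2) = χ := by rw [hχ]; ring
    rwa [e] at this
  have hmain := CorvajaZannier2008_cor23_arith (M := ∑ᶠ v : PlaceOver K F,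
      (if v ∈ S then (0 : ℤ) else min (v.ord (1 - a)) (v.ord (1 - b)))) hHb1 hab hd1 hχd' hHa hMb hP
  have hχR : (χ : ℝ) = (S.card : ℝ) + (2 * (genus K F : ℝ) - 2) := by
    have := congrArg (fun z : ℤ ↦ (z : ℝ)) hχ
    push_cast at this
    linarith
  rw [hχR] at hmain
  exact hmain

end core

/-- **Corvaja–Zannier 2008, Corollary 2.3 (i)** — discharge of the named fact
`CorvajaZannier2008_cor23` (J. Algebraic Geom. 17 (2008), §2): for `S`-units `a, b` of the function field
`F` of a curve over an algebraically closed field of characteristic `0`, not both constant and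
multiplicatively independent modulo constants,
`Σ_{v ∉ S} min{v(1-a), v(1-b)} ≤ 3·∛2·(H(a)H(b)χ)^{1/3}`. Proof as printed (Prop. 2.2 with the optimal
`h, k`; the reduction to `κ(𝒞) = κ(a, b)` is replaced by the equivalent bookkeeping `H(a) = δ d`,
`χ ≥ d`, see the module docstring). [cite: CorvajaZannier2007, Cor. 2.3 (i)] -/
theorem CorvajaZannier2008_cor23_holds : CorvajaZannier2008_cor23 := by
  intro K _ _ _ F _ _ _ S a b _ ha0 hb0 hunit _ hindep
  haveI hic : IsIntegrallyClosedIn K F := isIntegrallyClosedIn_of_isAlgClosed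
  have hrat : ∀ P : PlaceOver K F, P.IsRational := PlaceOver.isRational_of_isAlgClosed
  have ha : a ∉ Set.range (algebraMap K F) := not_mem_range_of_indep ha0 hindep
  have hb : b ∉ Set.range (algebraMap K F) := not_mem_range_of_indep hb0 (indep_symm hindep)
  have hdeg : ∀ v : PlaceOver K F, (v.degree : ℤ) = 1 := fun v ↦ by exact_mod_cast hrat v
  simp only [hdeg, one_mul]
  -- the heights of the statement are the degrees `[F : K(a)]`, `[F : K(b)]`
  have hcast : ∀ {y : F}, y ∉ Set.range (algebraMap K F) →
      ∑ᶠ v : PlaceOver K F, ((max 0 (-v.ord y) : ℤ) : ℝ) = (finrank K⟮y⟯ F : ℝ) := by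
    intro y hy
    have hy0 : y ≠ 0 := fun h ↦ hy ⟨0, by rw [h, map_zero]⟩
    have hfin : (Function.support fun v : PlaceOver K F ↦ max 0 (-v.ord y)).Finite := by
      refine (finite_setOf_ord_ne_zero_holds (K := K) hy0).subset fun v hv ↦ ?_
      rw [Function.mem_support] at hv
      rw [Set.mem_setOf_eq]
      intro h0
      exact hv (by rw [h0, neg_zero, max_self])
    have h := (Int.castAddHom ℝ).map_finsum hfin
    simp only [Int.coe_castAddHom] at h
    rw [← h, finsum_max_neg_ord_eq_finrank hrat hy, Int.cast_natCast]
  rw [hcast ha, hcast hb]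
  rcases le_total (finrank K⟮b⟯ F) (finrank K⟮a⟯ F) with hle | hle
  · exact CorvajaZannier2008_cor23_of_le S ha0 hb0 hunit hindep hle
  · have h := CorvajaZannier2008_cor23_of_le S hb0 ha0 (fun v hv ↦ (hunit v hv).symm) (indep_symm hindep) hle
    have e1 : (fun v : PlaceOver K F ↦ if v ∈ S then (0 : ℤ) else min (v.ord (1 - b)) (v.ord (1 - a))) =
        fun v ↦ if v ∈ S then (0 : ℤ) else min (v.ord (1 - a)) (v.ord (1 - b)) := by
      funext v; rw [min_comm]
    have e2 : 2 * (finrank K⟮b⟯ F : ℝ) * (finrank K⟮a⟯ F : ℝ) =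
        2 * (finrank K⟮a⟯ F : ℝ) * (finrank K⟮b⟯ F : ℝ) := by ring
    rw [e1, e2] at h
    exact h

end Literature.NumberTheory.DiophantineGeometry
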